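import Summits.HodgeConjecture.CorCM.MultiFieldWeilUnitsMenu
import HarnessLib

/-!
# MULTI-FIELD WEIL ENGINE — THE INDEPENDENCE CRITERION, USER-FACING: any number of pairwise non-isogenous structures per field of the menu whose CENTRED TYPE INDICATORS
# `n·𝟙_Φ − p·𝟙` on the `τ`-embeddings are LINEARLY INDEPENDENT — the Hodge conjecture for every product of copies, given only Markman's fourfold and hyperbolic-sixfold theorems

Cell `pub-hodgecm2` (COR-CM), seat b30 gen 39 (2026-08-25); count-neutral own lane MULTI-FIELD WEIL ENGINE (stem `MultiFieldWeil*`), the general form of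
`CorCM/MultiFieldWeilUnitsMenu.lean` (U4, `hodgeConjectureFor_biproduct_comp_of_unitsMenu`: the independent patterns proved type-free — ≤ 2 classes per sextic field, ≤ 3 per
octic field with «#(2,2) ≠ 1», ≤ 3 per decic field).  Here the unit hypothesis is U1's CRITERION ITSELF (`const_of_signed_unit_of_linearIndependent`): for every field carrying
three or more slots, the centred indicators of their types, transported to one copy of the field (`HEq`), are linearly independent over `ℚ` (`hli3`); units of two slots stay
type-free (non-isogeny + Shimura's criterion + U1 `linearIndependent_cells_of_two`).  PRICE: the types must be given NORMALISED (`hcnt`: `1` member over `τ` for sextic, `1` or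
`2` for octic, `2` for decic fields — replace a structure by its complex conjugate otherwise, `exists_realisation_card_eq_of_or`), because the normalisation of U4 is existential
and would lose the connection with the stated types.  Theorems only; no definition, no named fact, no `sorry`.  HONEST FRAMING: conditional ONLY on the two displayed Markman
binders; `HC_CM` is NOT proved and not asserted.

**`hodgeConjectureFor_biproduct_comp_of_unitsMenu_of_linearIndependent`.**  Slots `is : Fin r → I` over CM fields `Kf i ⊇ iK i (k)`, `k = Kf i₀` imaginary quadratic,
`E = A 0 ⊨ (k; {τ})`, `B_m = A (m+1) ⊨ (K_{is m}; Φ (m+1))` with `(n_m, p_m) ∈ {(3,1), (4,1), (4,2), (5,2)}` (`p_m` = members of `Φ (m+1)` over `τ`); sextic slots SIMPLE; slots of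
one field pairwise NON-ISOGENOUS; `hli3` as above for fields with `≥ 3` slots; every octic field with a degree-`24` pair; every decic field with `≥ 2` slots with a degree-`40`
pair (fibre sizes are stated instance-free: «there is another slot ∕ two other slots with the same index»); `Hom(K_i, K_{i'}) = ∅` for different indices of equal degree; octic → sextic a value outside the closure.  THEN the Hodge conjecture holds for EVERY product of copies
`⨁_j A(κ j)`, GIVEN ONLY Markman's two theorems.  COVERS beyond U4 (by U1's sharp criterion): the octic triple «`B_q, B_{q'}` of signature `(1,3)` and a `(2,2)`-class at
`S ∉ {{q,q'}, {q,q'}ᶜ}`»; the `185` independent decic quadruples; any independent family.  NOT covered (DEPENDENT, genuinely new classes): `B_q, B_{q'}, B_{{q,q'}}` over an octic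
field; four octic or five decic classes; three sextic classes.  (Dominated form: compose with `Domination.hodgeConjectureFor_of_avDominatedBy`.)

PROOF.  U4's, with `Φ' = Φ` (no normalisation) and, on a unit of `≥ 3` slots, the transported types `Ψ_x` (`castT`, `HEq`) read through the unit's frame: on the `τ`-side
`s ∈ Ψ_x ↔ (e s).1 ∈ Q_x`, so a dependency of the position-set indicators pulls back to a dependency of the type indicators (`Fintype.linearIndependent_iff`, `Fintype.sum_equiv`).

[cite: Markman2025SurveySecant, Thm. 1.2] [cite: Markman2025SecantWeil, Thm 1.5.1] [cite: Shimura1998, §6.1 Corollary of Theorem 2, §8.2 Prop. 26, §8.4, §18.2 Lemma (i)]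
[cite: Deligne1982HodgeCycles, §5 (b)] [cite: Lang2002, VI §1 Thm. 1.14 and V §2 Thm. 2.8; XIII §4] [cite: MoonenZarhin1995Duke, Thm. 2.4] [cite: Pohlmann1968, Thm 1]
[cite: DixonMortimer1996, §1.4 Ex. 1.4.1–1.4.2; §1.6, Thm. 1.6A; §2.1; §3.3, Thm. 3.3A] [cite: Dodson1984, §1.1 Imprimitivity Theorem and §5.1.2 Theorem] [cite: MumfordAV1970, §19]

## References
* [Markman2025SurveySecant] E. Markman, arXiv:2509.23403, Thm. 1.2.  [Markman2025SecantWeil] E. Markman, Cycles on abelian 2n-folds of Weil type from secant sheaves on abelian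
  n-folds, Thm 1.5.1.  [Shimura1998] G. Shimura, *Abelian varieties with complex multiplication and modular functions*, §6.1, §8.2, §8.4, §18.2.  [Deligne1982HodgeCycles]
  P. Deligne, LNM 900, §5 (b).  [Lang2002] S. Lang, *Algebra*, GTM 211, V §2, VI §1, XIII §4.  [MoonenZarhin1995Duke] B. Moonen, Yu. Zarhin, Duke Math. J. 77 (1995), Thm. 2.4.
  [Pohlmann1968] H. Pohlmann, Ann. of Math. 88 (1968), Thm 1.  [DixonMortimer1996] J. D. Dixon, B. Mortimer, *Permutation Groups*, GTM 163.  [Dodson1984] B. Dodson, Trans. AMS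
  283 (1984).  [MumfordAV1970] D. Mumford, *Abelian Varieties*, §19.
-/

noncomputable section

open CategoryTheory CategoryTheory.Limits NumberField IntermediateField

namespace Summit.HodgeConjecture.CorCM.MultiFieldWeil

open Finset
open Literature.AlgebraicGeometry Literature.AlgebraicGeometry.Motives Literature.AlgebraicGeometry.HodgeTheory
open Literature.AlgebraicGeometry.ComplexMultiplication (IsCMTypeRealisation)
open Literature.AlgebraicTopology.SingularHomology
open Literature.NumberTheory.ComplexMultiplication
open Summit.HodgeConjecture.CorCM.Census.MultiFieldWeil

open scoped Classical

/-! ## The menu with several isogeny classes per field -/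

section UnitsMenu

variable {I : Type} {r : ℕ} {Kf : I → Type} [∀ i, Field (Kf i)] [∀ i, NumberField (Kf i)] [∀ i, IsCMField (Kf i)]
  {i₀ : I} {is : Fin r → I} {τ : Kf i₀ →+* ℂ}
  {A : Fin (r + 1) → AbelianVariety ℂ} {Φ : ∀ j : Fin (r + 1), CMType (Kf (mfSlots i₀ is j))}
  {ι : ∀ j, 𝓞 (Kf (mfSlots i₀ is j)) →+* End (A j)}
  {θ : ∀ j, Kf (mfSlots i₀ is j) →+* Module.End ℂ (complexBetti (A j).X 1)}

/-- **THE INDEPENDENCE CRITERION, USER-FACING: ANY INDEPENDENT FAMILY OF CLASSES PER FIELD INSIDE THE NON-ISOMORPHIC MENU — GIVEN ONLY MARKMAN'S FOURFOLD AND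
HYPERBOLIC-SIXFOLD THEOREMS.**  See the module docstring.  `HC_CM` is NOT asserted. [cite: Markman2025SurveySecant, Thm. 1.2] [cite: Markman2025SecantWeil, Thm 1.5.1]
[cite: Shimura1998, §6.1 Corollary of Theorem 2, §8.2 Prop. 26, §18.2] [cite: Deligne1982HodgeCycles, §5 (b)] [cite: DixonMortimer1996, §1.4 Ex. 1.4.1–1.4.2; §1.6, Thm. 1.6A; §2.1]
[cite: Dodson1984, §1.1 Imprimitivity Theorem and §5.1.2 Theorem] [cite: Lang2002, XIII §4] -/
theorem hodgeConjectureFor_biproduct_comp_of_unitsMenu_of_linearIndependent (hW4 : Markman2025_weilClasses_algebraic_abelianFourfold)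
    (hM6 : Markman2025_weilClasses_algebraic_hyperbolicSixfold) {N : ℕ} (κ : Fin N → Fin (r + 1)) (h2 : Module.finrank ℚ (Kf i₀) = 2) (nI : I → ℕ)
    (hdeg : ∀ m : Fin r, Module.finrank ℚ (Kf (is m)) = 2 * nI (is m))
    (iK : ∀ i : I, Kf i₀ →+* Kf i) (hA : ∀ j, IsCMTypeRealisation (Φ j) (A j) (ι j) (θ j)) (hΨ : ∀ σ : Kf i₀ →+* ℂ, σ ∈ (Φ 0).1 ↔ σ = τ)
    (hS : ∀ m : Fin r, nI (is m) = 3 → (A m.succ).IsSimple)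
    (hcnt : ∀ m : Fin r, (nI (is m) = 3 ∧ (Finset.univ.filter fun s : Kf (is m) →+* ℂ => s.comp (iK (is m)) = τ ∧ s ∈ (Φ m.succ).1).card = 1) ∨
      (nI (is m) = 4 ∧ (Finset.univ.filter fun s : Kf (is m) →+* ℂ => s.comp (iK (is m)) = τ ∧ s ∈ (Φ m.succ).1).card = 1) ∨
      (nI (is m) = 4 ∧ (Finset.univ.filter fun s : Kf (is m) →+* ℂ => s.comp (iK (is m)) = τ ∧ s ∈ (Φ m.succ).1).card = 2) ∨
      (nI (is m) = 5 ∧ (Finset.univ.filter fun s : Kf (is m) →+* ℂ => s.comp (iK (is m)) = τ ∧ s ∈ (Φ m.succ).1).card = 2))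
    (hni : ∀ m m' : Fin r, m' ≠ m → is m' = is m → ¬ AbelianVariety.IsIsogenous (A m.succ) (A m'.succ))
    (hli3 : ∀ m₀ : Fin r, (∃ m₁ m₂ : Fin r, m₁ ≠ m₂ ∧ m₁ ≠ m₀ ∧ m₂ ≠ m₀ ∧ is m₁ = is m₀ ∧ is m₂ = is m₀) →
      ∀ Ψ : {m : Fin r // is m = is m₀} → CMType (Kf (is m₀)), (∀ m, HEq (Ψ m) (Φ m.1.succ)) →
      LinearIndependent ℚ fun m : {m : Fin r // is m = is m₀} => fun s : {s : Kf (is m₀) →+* ℂ // s.comp (iK (is m₀)) = τ} =>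
        ((nI (is m₀) : ℚ) * (if s.1 ∈ (Ψ m).1 then 1 else 0) -
          ((Finset.univ.filter fun t : Kf (is m₀) →+* ℂ => t.comp (iK (is m₀)) = τ ∧ t ∈ (Ψ m).1).card : ℚ)))
    (h24 : ∀ m : Fin r, nI (is m) = 4 → ∃ s₀ t₀ : Kf (is m) →+* ℂ, s₀.comp (iK (is m)) = τ ∧ t₀.comp (iK (is m)) = τ ∧ s₀ ≠ t₀ ∧
      Module.finrank ℚ ↥(adjoin ℚ (Set.range τ) ⊔ adjoin ℚ (Set.range s₀ ∪ Set.range t₀)) = 24)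
    (h40 : ∀ m : Fin r, nI (is m) = 5 → (∃ m' : Fin r, m' ≠ m ∧ is m' = is m) → ∃ s₀ t₀ : Kf (is m) →+* ℂ,
      s₀.comp (iK (is m)) = τ ∧ t₀.comp (iK (is m)) = τ ∧ s₀ ≠ t₀ ∧ Module.finrank ℚ ↥(adjoin ℚ (Set.range τ) ⊔ adjoin ℚ (Set.range s₀ ∪ Set.range t₀)) = 40)
    (hiso : ∀ m₀ m : Fin r, is m ≠ is m₀ → nI (is m₀) = nI (is m) → IsEmpty (Kf (is m) →+* Kf (is m₀)))
    (hout43 : ∀ m₀ m : Fin r, nI (is m₀) = 4 → nI (is m) = 3 → ∃ s : Kf (is m) →+* ℂ, s.comp (iK (is m)) = τ ∧ ∃ x, s x ∉ normalClosure ℚ (Kf (is m₀)) ℂ) :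
    HodgeConjectureFor (⨁ fun j => A (κ j)).dim (⨁ fun j => A (κ j)).X := by
  have hττ : ComplexEmbedding.conjugate τ ≠ τ := QuarticCM.conjugate_ne τ
  have hk : ∀ σ : Kf i₀ →+* ℂ, σ = τ ∨ σ = ComplexEmbedding.conjugate τ := fun σ => QuarticCM.eq_or_eq_conjugate_of_quadratic h2 τ σ
  obtain ⟨δ₀, d, hd, hδ₀⟩ := CyclicSextic.exists_sq_eq_neg_nat_of_isTotallyComplex (Kf i₀) h2
  obtain ⟨δ, hδ, hτ⟩ := OcticCurveFourfold.exists_delta_of_mem h2 hd hδ₀ τ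
  let im : ∀ m : Fin r, Kf i₀ →+* Kf (is m) := fun m => iK (is m)
  have hnn : ∀ {m m' : Fin r}, is m' = is m → nI (is m') = nI (is m) := fun h => congrArg nI h
  -- (0) transports across an equality of indices, by substitution
  have castT : ∀ i j : I, i = j → ∀ (Ψ : CMType (Kf i)) (B : AbelianVariety ℂ) (ιB : 𝓞 (Kf i) →+* End B)
      (θB : Kf i →+* Module.End ℂ (complexBetti B.X 1)), IsCMTypeRealisation Ψ B ιB θB →
      ∃ (Ψ₂ : CMType (Kf j)) (ι₂ : 𝓞 (Kf j) →+* End B) (θ₂ : Kf j →+* Module.End ℂ (complexBetti B.X 1)), HEq Ψ₂ Ψ ∧ IsCMTypeRealisation Ψ₂ B ι₂ θ₂ := by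
    intro i j h; subst h; exact fun Ψ B ιB θB hB => ⟨Ψ, ιB, θB, HEq.rfl, hB⟩
  have countT : ∀ i j : I, i = j → ∀ (Ψ : CMType (Kf i)) (Ψ₂ : CMType (Kf j)), HEq Ψ₂ Ψ → (Finset.univ.filter fun s : Kf i →+* ℂ => s.comp (iK i) = τ ∧ s ∈ Ψ.1).card =
      (Finset.univ.filter fun s : Kf j →+* ℂ => s.comp (iK j) = τ ∧ s ∈ Ψ₂.1).card := by
    intro i j h; subst h; intro Ψ Ψ₂ hh; cases hh; rfl
  -- (1) the counts (normalised by hypothesis): threefolds `1`, fourfolds `1` or `2`, fivefolds `2`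
  have hnI : ∀ m : Fin r, nI (is m) = 3 ∨ nI (is m) = 4 ∨ nI (is m) = 5 := fun m => by
    rcases hcnt m with ⟨h, -⟩ | ⟨h, -⟩ | ⟨h, -⟩ | ⟨h, -⟩
    exacts [Or.inl h, Or.inr (Or.inl h), Or.inr (Or.inl h), Or.inr (Or.inr h)]
  have hex : ∀ m : Fin r, ∃ pm : ℕ, (Finset.univ.filter fun s : Kf (is m) →+* ℂ => s.comp (im m) = τ ∧ s ∈ (Φ m.succ).1).card = pm := fun m => ⟨_, rfl⟩
  choose p hp using hex
  have hnp : ∀ m : Fin r, (nI (is m) = 3 ∧ p m = 1) ∨ (nI (is m) = 4 ∧ p m = 1) ∨ (nI (is m) = 4 ∧ p m = 2) ∨ (nI (is m) = 5 ∧ p m = 2) := fun m => by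
    rw [← hp m]; exact hcnt m
  have hn0 : ∀ m, 0 < nI (is m) := fun m => by rcases hnI m with h | h | h <;> rw [h] <;> norm_num
  have hexs : ∀ m : Fin r, ∃ s : Kf (is m) →+* ℂ, s.comp (im m) = τ := fun m => by
    have hc := SexticOcticWeil.card_filter_comp_eq_of_finrank (n := nI (is m)) (im m) (hdeg m) h2 τ
    obtain ⟨s, hs⟩ := Finset.card_pos.1 (by rw [hc]; exact hn0 m)
    exact ⟨s, (Finset.mem_filter.1 hs).2⟩
  -- (2) the units: a representative map for the fibres of `is`
  obtain ⟨U, hU⟩ := exists_unitRep is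
  -- (3) ONE SIGN FRAME PER INDEX
  have hfr : ∀ (i : I) (ni : ℕ), Module.finrank ℚ (Kf i) = 2 * ni → ∃ E : (Kf i →+* ℂ) ≃ Fin ni × Bool,
      (∀ s, (E s).2 = true ↔ s.comp (iK i) = τ) ∧ ∀ s, E (ComplexEmbedding.conjugate s) = ((E s).1, !(E s).2) := fun i ni hdi => exists_signFrame hdi h2 (iK i) hττ hk
  choose E hE_sign hE_conj using hfr
  have readT : ∀ i j : I, ∀ h : j = i, ∀ (hi : Module.finrank ℚ (Kf i) = 2 * nI i) (hj : Module.finrank ℚ (Kf j) = 2 * nI j) (Ψ : CMType (Kf i)) (Ψ₂ : CMType (Kf j))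
      (Q : Finset (Fin (nI j))), HEq Ψ Ψ₂ → (∀ s, s ∈ Ψ₂.1 ↔ (E j (nI j) hj s).2 = decide ((E j (nI j) hj s).1 ∈ Q)) →
      ∀ s, s ∈ Ψ.1 ↔ (E i (nI i) hi s).2 = decide ((E i (nI i) hi s).1 ∈ Q.image (Fin.cast (congrArg nI h))) := by
    intro i j h; subst h; intro hi hj Ψ Ψ₂ Q hh hr; have hΨ : Ψ = Ψ₂ := eq_of_heq hh; subst hΨ; rw [image_cast_self]; exact hr
  have diagT : ∀ i j : I, ∀ h : i = j, ∀ (hi : Module.finrank ℚ (Kf i) = 2 * nI i) (hj : Module.finrank ℚ (Kf j) = 2 * nI j) (ρ : ℂ →+* ℂ)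
      (a : Fin (nI i)) (x : Fin (nI i)) (y : Fin (nI j)),
      ρ.comp ((E i (nI i) hi).symm (a, true)) = (E i (nI i) hi).symm (x, true) →
      ρ.comp ((E j (nI j) hj).symm (Fin.cast (congrArg nI h) a, true)) = (E j (nI j) hj).symm (y, true) → Fin.cast (congrArg nI h) x = y := by
    intro i j h; subst h; intro hi hj ρ a x y h₁ h₂
    rw [(Fin.ext rfl : Fin.cast (congrArg nI (rfl : i = i)) a = a)] at h₂
    exact (Fin.ext rfl : Fin.cast _ x = x).trans (Prod.mk.inj ((E i (nI i) hi).symm.injective (h₁.symm.trans h₂))).1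
  -- (4) the frames of the slots, their readings and position sets
  let e : ∀ m : Fin r, (Kf (is m) →+* ℂ) ≃ Fin (nI (is m)) × Bool := fun m => E (is m) (nI (is m)) (hdeg m)
  have he_sign : ∀ (m : Fin r) (s : Kf (is m) →+* ℂ), (e m s).2 = true ↔ s.comp (im m) = τ := fun m => hE_sign (is m) (nI (is m)) (hdeg m)
  have he_conj : ∀ (m : Fin r) (s : Kf (is m) →+* ℂ), e m (ComplexEmbedding.conjugate s) = ((e m s).1, !(e m s).2) := fun m => hE_conj (is m) (nI (is m)) (hdeg m)
  let P : ∀ m : Fin r, Finset (Fin (nI (is m))) := fun m => Finset.univ.filter fun a : Fin (nI (is m)) => (e m).symm (a, true) ∈ (Φ m.succ).1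
  have hΦ : ∀ (m : Fin r) (s : Kf (is m) →+* ℂ), s ∈ (Φ m.succ).1 ↔ (e m s).2 = decide ((e m s).1 ∈ P m) := fun m s =>
    mem_iff_snd_eq_decide_mem_posSet (he_conj m) (Φ m.succ) s
  have hcard : ∀ m : Fin r, (P m).card = p m := fun m => (card_posSet (he_sign m) (Φ m.succ)).trans (hp m)
  -- the partner structures of a unit, transported to the slot's own field and read through the cast
  have hpartner : ∀ (m m' : Fin r) (h : is m' = is m), ∃ (Ψ₂ : CMType (Kf (is m))) (ι₂ : 𝓞 (Kf (is m)) →+* End (A m'.succ))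
      (θ₂ : Kf (is m) →+* Module.End ℂ (complexBetti (A m'.succ).X 1)), IsCMTypeRealisation Ψ₂ (A m'.succ) ι₂ θ₂ ∧
      (Finset.univ.filter fun s : Kf (is m) →+* ℂ => s.comp (im m) = τ ∧ s ∈ Ψ₂.1).card = p m' ∧
      (∀ s, s ∈ Ψ₂.1 ↔ (e m s).2 = decide ((e m s).1 ∈ (P m').image (Fin.cast (hnn h)))) ∧ HEq Ψ₂ (Φ m'.succ) := by
    intro m m' h
    obtain ⟨Ψ₂, ι₂, θ₂, hh₂, hA₂⟩ := castT _ _ h (Φ m'.succ) (A m'.succ) (ι m'.succ) (θ m'.succ) (hA m'.succ)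
    exact ⟨Ψ₂, ι₂, θ₂, hA₂, (countT _ _ h (Φ m'.succ) Ψ₂ hh₂).symm.trans (hp m'),
      readT _ _ h (hdeg m) (hdeg m') Ψ₂ (Φ m'.succ) (P m') hh₂ (hΦ m'), hh₂⟩
  -- two slots of one unit: position sets neither equal nor complementary (Shimura's isogeny criterion)
  have hdist : ∀ (m m' : Fin r) (h : is m' = is m), m' ≠ m → (P m').image (Fin.cast (hnn h)) ≠ P m ∧ (P m').image (Fin.cast (hnn h)) ≠ (P m)ᶜ := by
    intro m m' h hne
    obtain ⟨Ψ₂, ι₂, θ₂, hA₂, -, hr₂, -⟩ := hpartner m m' h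
    have hsh := DihedralSexticPair.cmType_ne_and_ne_compl_of_not_isIsogenous (hA m.succ) hA₂ (hni m m' hne h)
    refine ⟨fun hq => hsh.1 (Set.ext fun s => (hΦ m s).trans (by rw [← hq]; exact (hr₂ s).symm)), fun hq => hsh.2 (Set.ext fun s => ?_)⟩
    have hX : ((e m s).2 = decide ((e m s).1 ∈ (P m').image (Fin.cast (hnn h)))) ↔ ¬ ((e m s).2 = decide ((e m s).1 ∈ P m)) :=
      eq_decide_iff_not_eq_decide (by rw [hq, Finset.mem_compl])
    exact (hr₂ s).trans ((hX.trans (not_congr (hΦ m s)).symm).trans (Set.mem_compl_iff _ _).symm)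
  -- (5) the realised tuples are DIAGONAL on every unit
  have hdg : ∀ π ∈ realisedTuples e τ, ∀ (m m' : Fin r) (h : U m' = U m) (a : Fin (nI (is m'))),
      Fin.cast (hnn ((hU m m').1 h)) (π m' a) = π m (Fin.cast (hnn ((hU m m').1 h)) a) := by
    intro π hπ m m' h a; obtain ⟨ρ, -, hρ⟩ := (mem_realisedTuples e τ π).1 hπ
    exact diagT _ _ ((hU m m').1 h) (hdeg m') (hdeg m) (ρ : ℂ →+* ℂ) a (π m' a) (π m (Fin.cast _ a)) (hρ m' a) (hρ m (Fin.cast _ a))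
  -- (6) `2`-transitivity: octic slots by degree `24`; units with two slots — sextic by T4 §1, decic by degree `40`
  have h2T4 : ∀ m, nI (is m) = 4 → ∀ s₁ s₂ s₁' s₂' : Kf (is m) →+* ℂ, s₁.comp (im m) = τ → s₂.comp (im m) = τ → s₁'.comp (im m) = τ → s₂'.comp (im m) = τ →
      s₁ ≠ s₂ → s₁' ≠ s₂' → ∃ ρ : ℂ ≃+* ℂ, (ρ : ℂ →+* ℂ).comp τ = τ ∧ (ρ : ℂ →+* ℂ).comp s₁ = s₁' ∧ (ρ : ℂ →+* ℂ).comp s₂ = s₂' := fun m h4 =>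
    h2T_of_finrank_pair_octic h2 im hdeg h24 m h4
  have h2t4 : ∀ m, nI (is m) = 4 → ∀ a b a' b' : Fin (nI (is m)), a ≠ b → a' ≠ b' → ∃ π ∈ realisedTuples e τ, π m a = a' ∧ π m b = b' := fun m h4 =>
    twoTransitive_realisedTuples_of_aut (e := e) he_sign m (h2T4 m h4)
  have hp1_3 : ∀ m, nI (is m) = 3 → p m = 1 := fun m h3m => by
    rcases hnp m with ⟨-, h⟩ | ⟨h, -⟩ | ⟨h, -⟩ | ⟨h, -⟩ <;> omega
  have h2t : ∀ m, (∃ m', m' ≠ m ∧ U m' = U m) → ∀ a a' b b' : Fin (nI (is m)), a ≠ a' → b ≠ b' → ∃ π ∈ realisedTuples e τ, π m a = b ∧ π m a' = b' := by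
    intro m hm; obtain ⟨m', hm'm, hUm'⟩ := hm
    have him : is m' = is m := (hU m m').1 hUm'
    rcases hnI m with h3m | h4 | h5
    · -- sextic: two non-isogenous simple threefolds over the field
      obtain ⟨Ψ₂, ι₂, θ₂, hA₂, hone₂, -, -⟩ := hpartner m m' him
      exact twoTransitive_realisedTuples_of_aut (e := e) he_sign m
        (twoTransitive_aut_of_sextic_twins (by rw [hdeg m, h3m]) h2 (im m) τ (hA m.succ) hA₂ (hS m h3m)
          (hS m' (by rw [him]; exact h3m)) (hni m m' hm'm him) ((hp m).trans (hp1_3 m h3m)) (hone₂.trans (hp1_3 m' (by rw [him]; exact h3m))))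
    · exact h2t4 m h4
    · -- decic: degree `40`
      obtain ⟨s₀, t₀, hs₀, ht₀, hst₀, hd40⟩ := h40 m h5 ⟨m', hm'm, him⟩
      exact twoTransitive_realisedTuples_of_aut (e := e) he_sign m
        (twoTransitive_aut_of_finrank_pair h2 im m (nm := 5) (by rw [hdeg m, h5]) hs₀ ht₀ hst₀ (by rw [hd40]))
  -- (7) stabiliser-transitivity across units: `Hom = ∅` within each degree (W1, the 𝔖₄ lemma, Y1), a value outside for octic → sextic, free otherwise
  have hout : ∀ m₀ m : Fin r, is m ≠ is m₀ → (nI (is m₀) = nI (is m) ∨ (nI (is m₀) = 4 ∧ nI (is m) = 3)) →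
      ∃ s : Kf (is m) →+* ℂ, s.comp (im m) = τ ∧ ∃ x, s x ∉ normalClosure ℚ (Kf (is m₀)) ℂ := by
    intro m₀ m hne hnm; obtain ⟨s, hs⟩ := hexs m
    rcases hnm with heq | ⟨h4₀, h3⟩
    · rcases hnI m with h3 | h4 | h5
      · exact ⟨s, hs, exists_apply_not_mem_normalClosure_of_isEmpty_ringHom h2 im (by rw [hdeg m₀, heq, h3]) (by rw [hdeg m, h3]) (hiso m₀ m hne heq) s hs⟩
      · exact exists_outside_normalClosure_of_isEmpty_ringHom_four (n := fun l => nI (is l)) h2 hdeg im m₀ m (heq.trans h4) h4 (h2T4 m₀ (heq.trans h4))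
          (hiso m₀ m hne heq)
      · exact ⟨s, hs, exists_apply_not_mem_normalClosure_of_isEmpty_ringHom_five h2 im (by rw [hdeg m₀, heq, h5]) (by rw [hdeg m, h5]) (hiso m₀ m hne heq) s hs⟩
    · exact hout43 m₀ m h4₀ h3
  have hstab₀ : ∀ (m₀ m : Fin r), is m ≠ is m₀ → ∀ a a' : Fin (nI (is m)), ∃ ν ∈ realisedTuples e τ, ν m₀ = 1 ∧ ν m a = a' := by
    intro m₀ m hne a a'
    rcases hnI m with h3 | h4 | h5
    · rcases hnI m₀ with h3₀ | h4₀ | h5₀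
      · exact stabTransitive_realisedTuples_of_outside_prime (e := e) he_sign m₀ m (by rw [h3]; exact Nat.prime_three) (hout m₀ m hne (Or.inl (h3₀.trans h3.symm))) a a'
      · exact stabTransitive_realisedTuples_of_outside_prime (e := e) he_sign m₀ m (by rw [h3]; exact Nat.prime_three) (hout m₀ m hne (Or.inr ⟨h4₀, h3⟩)) a a'
      · exact stabTransitive_realisedTuples_of_sizes_three_five (e := e) he_sign m₀ m (Or.inl ⟨h5₀, h3⟩) a a'
    · rcases hnI m₀ with h3₀ | h4₀ | h5₀
      · exact stabTransitive_realisedTuples_into_four (e := e) he_sign m₀ m (Or.inl h3₀) h4 (h2t4 m h4) a a'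
      · exact stabTransitive_realisedTuples_of_outside_twoTransitive (e := e) he_sign m₀ m (h2t4 m h4) (hout m₀ m hne (Or.inl (h4₀.trans h4.symm))) a a'
      · exact stabTransitive_realisedTuples_into_four (e := e) he_sign m₀ m (Or.inr h5₀) h4 (h2t4 m h4) a a'
    · rcases hnI m₀ with h3₀ | h4₀ | h5₀
      · exact stabTransitive_realisedTuples_of_sizes_three_five (e := e) he_sign m₀ m (Or.inr ⟨h3₀, h5⟩) a a'
      · exact stabTransitive_realisedTuples_into_five_of_four (e := e) he_sign m₀ m h4₀ h5 a a'
      · exact stabTransitive_realisedTuples_of_outside_prime (e := e) he_sign m₀ m (by rw [h5]; exact Nat.prime_five) (hout m₀ m hne (Or.inl (h5₀.trans h5.symm))) a a'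
  have hstab : ∀ (m₀ m : Fin r), U m₀ ≠ U m → ∀ a a' : Fin (nI (is m)), ∃ ν ∈ realisedTuples e τ, (∀ m', U m' = U m₀ → ν m' = 1) ∧ ν m a = a' := by
    intro m₀ m hne a a'
    obtain ⟨ν, hν, hν0, hνa⟩ := hstab₀ m₀ m (fun h => hne ((hU m m₀).2 h.symm)) a a'
    refine ⟨ν, hν, fun m' hm' => Equiv.ext fun b => ?_, hνa⟩
    have hb := hdg ν hν m₀ m' hm' b; rw [hν0, Equiv.Perm.one_apply] at hb
    rw [Equiv.Perm.one_apply]; exact Fin.ext (by simpa only [Fin.val_cast] using congrArg Fin.val hb)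
  -- (8) the slot menu on the single slots
  have hkind : ∀ m : Fin r, (∀ m', U m' = U m → m' = m) → (nI (is m)).Prime ∨ p m = 1 ∨
      ∀ Q : Finset (Fin (nI (is m))), Q.card = p m → ∃ π ∈ realisedTuples e τ, preG (π m) (P m) = Q := by
    intro m _
    rcases hnp m with ⟨h, -⟩ | ⟨-, h'⟩ | ⟨h, h'⟩ | ⟨h, -⟩
    · exact Or.inl (by rw [h]; exact Nat.prime_three)
    · exact Or.inr (Or.inl h')
    · have hhom := homogeneous_two_of_twoTransitive (R := realisedTuples e τ) (P := P) (m := m) (by rw [hcard m, h']) (h2t4 m h)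
      exact Or.inr (Or.inr fun Q hQ => hhom Q (by rw [hQ, hcard m]))
    · exact Or.inl (by rw [h]; exact Nat.prime_five)
  -- (9) the centred indicators of every unit with two or three slots are linearly independent (U1 two sets; U2 §2 singletons; U5a the Gram patterns)
  have hP0 : ∀ m, (P m).Nonempty := fun m => Finset.card_pos.1 (by rw [hcard m]; rcases hnp m with ⟨-, h⟩ | ⟨-, h⟩ | ⟨-, h⟩ | ⟨-, h⟩ <;> rw [h] <;> norm_num)
  have hPn : ∀ m, (P m).card < nI (is m) := fun m => by
    rw [hcard m]; rcases hnp m with ⟨h, h'⟩ | ⟨h, h'⟩ | ⟨h, h'⟩ | ⟨h, h'⟩ <;> rw [h, h'] <;> norm_num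
  have hli : ∀ m, (∃ m', m' ≠ m ∧ U m' = U m) → LinearIndependent ℚ fun m' : {m' : Fin r // U m' = U m} => fun q : Fin (nI (is m)) =>
      ((nI (is m) : ℚ) * (if q ∈ (P m'.1).image (Fin.cast (hnn ((hU m m'.1).1 m'.2))) then 1 else 0) - (P m'.1).card) := by
    intro m hm; obtain ⟨m', hm'm, hUm'⟩ := hm
    have him : is m' = is m := (hU m m').1 hUm'
    have hix : ∀ x : {x : Fin r // U x = U m}, is x.1 = is m := fun x => (hU m x.1).1 x.2
    have hmemF : ∀ x : {x : Fin r // U x = U m}, x.1 ∈ Finset.univ.filter fun y : Fin r => is y = is m := fun x => by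
      simp only [Finset.mem_filter, Finset.mem_univ, true_and]; exact hix x
    -- the position sets of the unit read in `Fin (nI (is m))`; the cardinalities of the original sets equal those of the images
    let Q : {x : Fin r // U x = U m} → Finset (Fin (nI (is m))) := fun x => (P x.1).image (Fin.cast (hnn (hix x)))
    have hQcard : ∀ x, (Q x).card = p x.1 := fun x => by simp only [Q, Finset.card_image_of_injective _ (Fin.cast_injective _), hcard]
    have hfun : (fun m'' : {m'' : Fin r // U m'' = U m} => fun q : Fin (nI (is m)) =>
        ((nI (is m) : ℚ) * (if q ∈ (P m''.1).image (Fin.cast (hnn ((hU m m''.1).1 m''.2))) then 1 else 0) - (P m''.1).card)) =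
        fun m'' : {m'' : Fin r // U m'' = U m} => fun q : Fin (nI (is m)) => ((nI (is m) : ℚ) * (if q ∈ Q m'' then 1 else 0) - (Q m'').card) := by
      funext m'' q
      rw [hQcard, hcard]
    rw [hfun]
    -- distinct slots of the unit read neither equal nor complementary sets
    have hQne : ∀ x x' : {x : Fin r // U x = U m}, x' ≠ x → Q x' ≠ Q x ∧ Q x' ≠ (Q x)ᶜ := by
      intro x x' hne
      have hne1 : x'.1 ≠ x.1 := fun h => hne (Subtype.ext h)
      have hixx : is x'.1 = is x.1 := (hix x').trans (hix x).symm
      have hd := hdist x.1 x'.1 hixx hne1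
      have hcomp : Q x' = ((P x'.1).image (Fin.cast (hnn hixx))).image (Fin.cast (hnn (hix x))) := by
        show (P x'.1).image _ = _
        rw [Finset.image_image]
        rfl
      refine ⟨fun h => hd.1 (Finset.image_injective (Fin.cast_injective (hnn (hix x))) ?_), fun h => hd.2 (Finset.image_injective (Fin.cast_injective (hnn (hix x))) ?_)⟩
      · rw [← hcomp]; exact h
      · rw [← hcomp, h, ← compl_image_cast]
    by_cases hc2 : (Finset.univ.filter fun x : Fin r => is x = is m).card ≤ 2
    · -- exactly two slots: Shimura + U1's two-set lemma
      have huniv : ∀ x : {x : Fin r // U x = U m}, x = ⟨m, rfl⟩ ∨ x = ⟨m', hUm'⟩ := by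
        intro x
        have hF : ({m, m'} : Finset (Fin r)) = Finset.univ.filter fun y : Fin r => is y = is m :=
          Finset.eq_of_subset_of_card_le (fun y hy => by
              simp only [Finset.mem_insert, Finset.mem_singleton] at hy; simp only [Finset.mem_filter, Finset.mem_univ, true_and]; rcases hy with rfl | rfl; exacts [rfl, him])
            (by rw [Finset.card_pair hm'm.symm]; exact hc2)
        have hx := hmemF x
        rw [← hF, Finset.mem_insert, Finset.mem_singleton] at hx
        rcases hx with h | h
        exacts [Or.inl (Subtype.ext h), Or.inr (Subtype.ext h)]
      have hne := hQne ⟨m, rfl⟩ ⟨m', hUm'⟩ (fun h => hm'm (congrArg Subtype.val h))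
      exact linearIndependent_cells_of_two ⟨m, rfl⟩ ⟨m', hUm'⟩ (fun h => hm'm.symm (congrArg Subtype.val h)) huniv Q
        (fun x => (hP0 x.1).image _) (fun x => by rw [hQcard, ← hcard, ← hnn (hix x)]; exact hPn x.1) hne.1 hne.2
    · -- three or more slots: the independence hypothesis `hli3`, read through the frame of the unit
      push Not at hc2
      have hT : ∀ x : {x : Fin r // U x = U m}, ∃ Ψ : CMType (Kf (is m)), HEq Ψ (Φ x.1.succ) ∧
          (Finset.univ.filter fun t : Kf (is m) →+* ℂ => t.comp (im m) = τ ∧ t ∈ Ψ.1).card = p x.1 ∧ ∀ s, s ∈ Ψ.1 ↔ (e m s).2 = decide ((e m s).1 ∈ Q x) := fun x => by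
        obtain ⟨Ψ₂, -, -, -, hc₂, hr₂, hh₂⟩ := hpartner m x.1 (hix x); exact ⟨Ψ₂, hh₂, hc₂, hr₂⟩
      choose Ψ hΨheq hΨcnt hΨread using hT
      let ε : {y : Fin r // is y = is m} ≃ {x : Fin r // U x = U m} :=
        ⟨fun y => ⟨y.1, (hU m y.1).2 y.2⟩, fun x => ⟨x.1, hix x⟩, fun y => Subtype.ext rfl, fun x => Subtype.ext rfl⟩
      have h3 : ∃ m₁ m₂ : Fin r, m₁ ≠ m₂ ∧ m₁ ≠ m ∧ m₂ ≠ m ∧ is m₁ = is m ∧ is m₂ = is m := by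
        obtain ⟨a, b, c', ha, hb, hc', hab, hac, hbc⟩ := Finset.two_lt_card_iff.1 hc2
        simp only [Finset.mem_filter, Finset.mem_univ, true_and] at ha hb hc'
        by_cases ham : a = m
        · exact ⟨b, c', hbc, fun h => hab (ham.trans h.symm), fun h => hac (ham.trans h.symm), hb, hc'⟩
        · by_cases hbm : b = m
          · exact ⟨a, c', hac, ham, fun h => hbc (hbm.trans h.symm), ha, hc'⟩
          · exact ⟨a, b, hab, ham, hbm, ha, hb⟩
      have hind := Fintype.linearIndependent_iff.1 (hli3 m h3 (fun y => Ψ (ε y)) fun y => hΨheq (ε y))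
      rw [Fintype.linearIndependent_iff]
      intro g hg x
      have hzero := hind (fun y => g (ε y)) (by
        funext s
        have hq := congrFun hg (e m s.1).1
        rw [Finset.sum_apply, Pi.zero_apply] at hq ⊢
        refine Eq.trans (Fintype.sum_equiv ε _ _ fun y => ?_) hq
        have hs2 : (e m s.1).2 = true := (he_sign m s.1).2 s.2
        have hmem : s.1 ∈ (Ψ (ε y)).1 ↔ (e m s.1).1 ∈ Q (ε y) := by rw [hΨread, hs2, true_eq_decide_iff]
        simp only [Pi.smul_apply, smul_eq_mul]
        rw [hΨcnt (ε y), ← hQcard (ε y)]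
        by_cases h1 : (e m s.1).1 ∈ Q (ε y)
        · rw [if_pos h1, if_pos (hmem.2 h1)]
        · rw [if_neg h1, if_neg (mt hmem.1 h1)]) (ε.symm x)
      simpa only [Equiv.apply_symm_apply] using hzero
  -- (10) the engine with units and the slot menu; the single-slot Weil spaces from Markman's theorems
  exact hodgeConjectureFor_biproduct_comp_of_units_frames (is := is) (n := fun m => nI (is m)) P p hcard
    (fun m => by rcases hnp m with ⟨-, h⟩ | ⟨-, h⟩ | ⟨-, h⟩ | ⟨-, h⟩ <;> rw [h] <;> norm_num)
    (fun m => by rcases hnp m with ⟨h, h'⟩ | ⟨h, h'⟩ | ⟨h, h'⟩ | ⟨h, h'⟩ <;> rw [h, h'] <;> norm_num)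
    κ h2 im hτ hA e he_sign he_conj hΨ hΦ U (fun m m' h => hnn ((hU m m').1 h)) hdg h2t hstab hli hkind
    fun m => weilHyp_of_markman_intrinsic hW4 hM6 m (hnp m) (hdeg m) h2 hd hδ hA hΨ (hp m)

end UnitsMenu

end Summit.HodgeConjecture.CorCM.MultiFieldWeil

end
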